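/-
Copyright (c) 2026 the pub-hodgecm-mathlib formalisation cell (harness21).  Prover seat hodgecm-mathlib-A-p12 (g24), 2026-09-02.  «S3-ram» seeding wave (LEAD F0P3a-plan (g12∕g13);
owner F0P3a-p06 (g15); (Cnt2′) chair F0P3a-p07 (g14)): organ (B-ii) «SHELL CLASS LAW» of the (α₂) TYPE-(2) line, file 1 «THE CLASS-FLIPPING SIMILITUDE» (design memo
`F0/P3a/A-p12/g24/DESIGN-Bii-ShellClassLaw.A-p12g24.md`).  Kernel lane, `--supports stmt-HodgeConjecture-24833`.
-/
import Literature.NumberTheory.Rogawski1990.DepthZeroKappaTransferTypeTwoRamifiedRescaling   -- ★ p847537 (this seat): `trace_det_disc_one_add_smul_sub`, descent algebra; ⊇ ★ FILE C∕B∕A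
import HarnessLib

/-!
# The class-flipping similitude of a type-(2) torus at a tame-ramified place: `X = D_ϖ⁻¹·ι(g₀)·D_ϖ` with `g₀ ∈ L⁺_v[g]`, `det g₀` a unit of NON-SQUARE residue —
# a unit-multiplier similitude of `(L_w², Φ₂)` commuting with `γ_W` (Labesse–Langlands 1979 §2; Rogawski 1990 §4.9; Serre 1979 XIV §4)

Topic `NumberTheory/Rogawski1990`; namespace `Literature.NumberTheory.Automorphic.UnitaryGroup`.  THEOREMS ONLY (no definition, no instance, no notation, no named fact,
no `sorry`); kernel lane `--supports stmt-HodgeConjecture-24833`.  Cell `pub/hodgecm-mathlib` (D-0151), crux H413; «S3-ram» (count-neutral); seat A-p12 (g24).  HONEST LABEL: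
HC_CM is proved only modulo the cell's 2 remaining named inputs (hLiu418 24832, h413 24833) until rung 0 closes; nothing printed is asserted here (`2 × 2` algebra over a
local field and a finite-field norm-form fact).

THE MATHEMATICS (organ (B-ii), step 1 of the memo).  The (W1) descent writes a type-(2) `u ∈ U(σ_w, Φ₂)(L_w)` as `u = D⁻¹(s·ιg)D`, `D = diag(1, ϖ)`, `g ∈ GL₂(L⁺_v)` with
`tr²g − 4det g = ε₀z²`, `ε₀` a unit of non-square residue (even depth).  (§1) For ANY `g′ ∈ M₂(L⁺_v)` the conjugate `X := D⁻¹·ι(g′)·D` satisfies the SIMILITUDE IDENTITY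
`ᵗσ(X)·J·X = ι(det g′)·J`, `J = antidiag(1,1)` (`σ` fixes `ι`, `σϖ = −ϖ`).  (§2) The traceless `τ := g − ½t·1` has `τ² = ¼ε₀z²·1`; the elements `g₀ := a·1 + b·τ` of the
commutative algebra `L⁺_v[g]` COMMUTE with `g` and have `det g₀ = a² − ¼ε₀z²·b²`; since the residual NORM FORM `x² − ε̄₀y²` of `𝓀(√ε̄₀)∕𝓀` is onto `𝓀` (Mathlib
`FiniteField.exists_root_sum_quadratic`, `|𝓀|` odd), there are integral `a, b′ = bz∕2` with `det g₀` a unit of NON-SQUARE residue (`|x² − det g₀|_v = 1` for every `x ∈ 𝒪_v`).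
(§3) Consequently `X₀ := D⁻¹·ι(g₀)·D` is a similitude of `(L_w², J)` with UNIT multiplier `ν = ι(det g₀)` of non-square residue which COMMUTES with `u` and normalises
`U(σ_w, J)`: `h ↦ X₀hX₀⁻¹` maps `U` to `U`.  These are the inputs of the class flip (memo steps 2–4; file 2): `B ↦ X₀B` permutes the `γ_W`-fixed self-dual lattices, preserves
every depth shell, and multiplies the residual rank-1 form by `ν̄` — so the two residual classes have equal size on every shell.

* §1 `formCongr_conj_diagonal_map` (the similitude identity), `conj_mem_unitaryGroupOfForm_of_similitude` (unit… any multiplier: `XhX⁻¹ ∈ U` for `h ∈ U`).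
* §2 `exists_residual_norm_nonsquare` (finite residue field, odd), **`exists_commuting_det_nonsquare`** (`g₀ ∈ L⁺_v[g]` integral-free statement: commutes with `g`, `det g₀`
  a unit with `|x² − det g₀|_v = 1 ∀ x ∈ 𝒪_v`).
* §3 **`exists_classFlip_similitude`** — for `u` with descent `(s, g)`: `∃ X₀ ∈ GL₂(L_w), ν ∈ L⁺_v`, `ᵗσ(X₀)JX₀ = ι(ν)·J`, `|ν|_v = 1`, `|y² − ν|_v = 1` on `𝒪_v` (non-square residue),
  `X₀·u = u·X₀`, and `∀ h ∈ U, X₀hX₀⁻¹ ∈ U`.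

## References
* [LabesseLanglands1979] J.-P. Labesse, R. P. Langlands, *L-indistinguishability for SL(2)*, Canad. J. Math. 31 (1979): §2 (tori in `GL₂`, their normalisers and orbits).
* [Rogawski1990] J. D. Rogawski, *Automorphic Representations of Unitary Groups in Three Variables* (1990): §4.9 pp. 54–56; §3.6.
* [Serre1979] J.-P. Serre, *Local Fields*, GTM 67 (1979): Ch. XIV §4 (norm residue), Ch. V §2.
-/

set_option autoImplicit false

noncomputable section

open MeasureTheory Measure Set NumberField IsDedekindDomain Matrix ValuativeRel MulAction Finset Polynomial
open scoped ValuativeRel Matrix MatrixGroups WithZero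

namespace Literature.NumberTheory.Automorphic.UnitaryGroup

open Literature.NumberTheory.Rogawski1990 Literature.NumberTheory.Automorphic Literature.NumberTheory.Automorphic.IntegralReduction
open Literature.NumberTheory.Automorphic.HermitianLatticeTree Literature.GroupTheory Literature.NumberTheory.GaloisRepresentations

/-! ## §1 The similitude identity of a twisted-diagonal conjugate -/

section Similitude

variable {F E : Type*} [Field F] [Field E] (ι : F →+* E) (σ : E →+* E)

/-- **`ᵗσ(X)·J·X = ι(det g)·J`** for `X = diag(1,α)⁻¹·ι(g)·diag(1,α)`, `J = antidiag(1,1)`, when `σ ∘ ι = ι` and `σα = −α`: the twisted-diagonal conjugate of a matrix over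
the fixed field is a SIMILITUDE of the hyperbolic hermitian plane with multiplier `det g`. [cite: LabesseLanglands1979, §2 p. 7] [cite: Rogawski1990, §4.9 p. 55] -/
theorem formCongr_conj_diagonal_map (hσι : ∀ x : F, σ (ι x) = ι x) {α : E} (hα : σ α = -α) (hα0 : α ≠ 0) (g : Matrix (Fin 2) (Fin 2) F) :
    ((Matrix.diagonal ![1, α⁻¹] * g.map ι * Matrix.diagonal ![1, α]).map σ)ᵀ * !![(0 : E), 1; 1, 0] * (Matrix.diagonal ![1, α⁻¹] * g.map ι * Matrix.diagonal ![1, α]) =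
      ι g.det • !![(0 : E), 1; 1, 0] := by
  have hαα : α * α⁻¹ = 1 := mul_inv_cancel₀ hα0
  have hσinv : σ α⁻¹ = -α⁻¹ := by rw [map_inv₀, hα, inv_neg]
  rw [Matrix.det_fin_two, map_sub, map_mul, map_mul]
  ext i j
  fin_cases i <;> fin_cases j <;>
    simp [Matrix.mul_apply, Fin.sum_univ_two, Matrix.diagonal, Matrix.transpose_apply, Matrix.map_apply, hσι, hα, hσinv] <;> field_simp <;> ring

/-- **Conjugation by a similitude preserves the unitary group**: if `ᵗσ(X)JX = ν·J` with `X` invertible, then `X h X⁻¹ ∈ U(σ, J)` for every `h ∈ U(σ, J)`.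
[cite: Rogawski1990, §4.9 p. 55] -/
theorem conj_mem_unitaryGroupOfForm_of_similitude {J : Matrix (Fin 2) (Fin 2) E} (X : GL (Fin 2) E) {ν : E}
    (hX : ((X : Matrix (Fin 2) (Fin 2) E).map σ)ᵀ * J * (X : Matrix (Fin 2) (Fin 2) E) = ν • J)
    (h : GL (Fin 2) E) (hh : h ∈ unitaryGroupOfForm σ J) : X * h * X⁻¹ ∈ unitaryGroupOfForm σ J := by
  rw [mem_unitaryGroupOfForm_iff] at hh ⊢
  -- `ᵗσ(X⁻¹) J X⁻¹ = ν⁻¹ J`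
  have hXinv : (((X⁻¹ : GL (Fin 2) E) : Matrix (Fin 2) (Fin 2) E).map σ)ᵀ * (ν • J) * ((X⁻¹ : GL (Fin 2) E) : Matrix (Fin 2) (Fin 2) E) = J := by
    rw [← hX]
    have h1 : (((X⁻¹ : GL (Fin 2) E) : Matrix (Fin 2) (Fin 2) E).map σ)ᵀ * ((X : Matrix (Fin 2) (Fin 2) E).map σ)ᵀ = 1 := by
      rw [← Matrix.transpose_mul, ← Matrix.map_mul, ← Units.val_mul, mul_inv_cancel, Units.val_one, Matrix.map_one σ (map_zero σ) (map_one σ), Matrix.transpose_one]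
    have h2 : (X : Matrix (Fin 2) (Fin 2) E) * ((X⁻¹ : GL (Fin 2) E) : Matrix (Fin 2) (Fin 2) E) = 1 := by rw [← Units.val_mul, mul_inv_cancel, Units.val_one]
    calc (((X⁻¹ : GL (Fin 2) E) : Matrix (Fin 2) (Fin 2) E).map σ)ᵀ * ((((X : Matrix (Fin 2) (Fin 2) E).map σ)ᵀ * J * (X : Matrix (Fin 2) (Fin 2) E))) * ((X⁻¹ : GL (Fin 2) E) : Matrix (Fin 2) (Fin 2) E)
        = ((((X⁻¹ : GL (Fin 2) E) : Matrix (Fin 2) (Fin 2) E).map σ)ᵀ * ((X : Matrix (Fin 2) (Fin 2) E).map σ)ᵀ) * J * ((X : Matrix (Fin 2) (Fin 2) E) * ((X⁻¹ : GL (Fin 2) E) : Matrix (Fin 2) (Fin 2) E)) := by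
          simp only [Matrix.mul_assoc]
      _ = J := by rw [h1, h2, Matrix.one_mul, Matrix.mul_one]
  rw [Units.val_mul, Units.val_mul, Matrix.map_mul, Matrix.map_mul, Matrix.transpose_mul, Matrix.transpose_mul]
  calc (((X⁻¹ : GL (Fin 2) E) : Matrix (Fin 2) (Fin 2) E).map σ)ᵀ * (((h : Matrix (Fin 2) (Fin 2) E).map σ)ᵀ * ((X : Matrix (Fin 2) (Fin 2) E).map σ)ᵀ) * J *
        ((X : Matrix (Fin 2) (Fin 2) E) * (h : Matrix (Fin 2) (Fin 2) E) * ((X⁻¹ : GL (Fin 2) E) : Matrix (Fin 2) (Fin 2) E))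
      = (((X⁻¹ : GL (Fin 2) E) : Matrix (Fin 2) (Fin 2) E).map σ)ᵀ * ((((h : Matrix (Fin 2) (Fin 2) E).map σ)ᵀ * ((((X : Matrix (Fin 2) (Fin 2) E).map σ)ᵀ * J * (X : Matrix (Fin 2) (Fin 2) E))) *
          (h : Matrix (Fin 2) (Fin 2) E))) * ((X⁻¹ : GL (Fin 2) E) : Matrix (Fin 2) (Fin 2) E) := by simp only [Matrix.mul_assoc]
    _ = (((X⁻¹ : GL (Fin 2) E) : Matrix (Fin 2) (Fin 2) E).map σ)ᵀ * (ν • J) * ((X⁻¹ : GL (Fin 2) E) : Matrix (Fin 2) (Fin 2) E) := by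
          rw [hX, Matrix.mul_smul, Matrix.smul_mul, hh]
    _ = J := hXinv

end Similitude

/-! ## §2 A commuting element with determinant of non-square residue -/

section NonSquare

variable (L : Type) [Field L] [NumberField L] [IsCMField L] (v : HeightOneSpectrum (𝓞 ↥(maximalRealSubfield L)))

set_option maxHeartbeats 400000 in
omit [IsCMField L] in
/-- **THE RESIDUAL NORM FORM IS ONTO THE NON-SQUARES**: for a unit `ε₀` of non-square residue and `|2|_v = 1` there are `a, b ∈ 𝒪_v` with `a² − ε₀b²` a unit of NON-SQUARE
residue, i.e. `|x² − (a² − ε₀b²)|_v = 1` for every `x ∈ 𝒪_v` (Mathlib `FiniteField.exists_root_sum_quadratic` on the odd residue field: `x² − ε̄₀y² = n̄` is soluble for a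
non-square `n̄`). [cite: Serre1979, Ch. XIV §4] -/
theorem exists_residual_norm_nonsquare (h2 : Valued.v (2 : (v.adicCompletion ↥(maximalRealSubfield L))) = 1)
    {ε₀ : (v.adicCompletion ↥(maximalRealSubfield L))} (hε₀ : ε₀ ∈ 𝒪[(v.adicCompletion ↥(maximalRealSubfield L))]) (hns : ∀ x : (v.adicCompletion ↥(maximalRealSubfield L)), x ∈ 𝒪[(v.adicCompletion ↥(maximalRealSubfield L))] → valuation (v.adicCompletion ↥(maximalRealSubfield L)) (x ^ 2 - ε₀) = 1) :
    ∃ a b : (v.adicCompletion ↥(maximalRealSubfield L)), a ∈ 𝒪[(v.adicCompletion ↥(maximalRealSubfield L))] ∧ b ∈ 𝒪[(v.adicCompletion ↥(maximalRealSubfield L))] ∧ valuation (v.adicCompletion ↥(maximalRealSubfield L)) (a ^ 2 - ε₀ * b ^ 2) = 1 ∧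
      ∀ x : (v.adicCompletion ↥(maximalRealSubfield L)), x ∈ 𝒪[(v.adicCompletion ↥(maximalRealSubfield L))] → valuation (v.adicCompletion ↥(maximalRealSubfield L)) (x ^ 2 - (a ^ 2 - ε₀ * b ^ 2)) = 1 := by
  classical
  haveI := finite_residueField_integer_adicCompletion L v
  letI : Fintype 𝓀[(v.adicCompletion ↥(maximalRealSubfield L))] := Fintype.ofFinite _
  have hchar : ringChar 𝓀[(v.adicCompletion ↥(maximalRealSubfield L))] ≠ 2 := by
    intro h
    have h2' : red (2 : (v.adicCompletion ↥(maximalRealSubfield L))) ≠ 0 := red_ne_zero_of_valuation_eq_one ((v_eq_one_iff_valuation_eq_one _).1 h2)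
    rw [red_two] at h2'
    apply h2'
    have h' : ((ringChar 𝓀[(v.adicCompletion ↥(maximalRealSubfield L))] : ℕ) : 𝓀[(v.adicCompletion ↥(maximalRealSubfield L))]) = 0 := ringChar.Nat.cast_ringChar
    rw [h] at h'
    exact_mod_cast h'
  have hodd : Fintype.card 𝓀[(v.adicCompletion ↥(maximalRealSubfield L))] % 2 = 1 := FiniteField.odd_card_of_char_ne_two hchar
  -- a residual non-square `n̄`, and the residue `ē` of `ε₀` (non-zero)
  obtain ⟨nbar, hn⟩ := FiniteField.exists_nonsquare hchar
  set e : 𝒪[(v.adicCompletion ↥(maximalRealSubfield L))] := ⟨ε₀, hε₀⟩ with he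
  have hebar : IsLocalRing.residue 𝒪[(v.adicCompletion ↥(maximalRealSubfield L))] e ≠ 0 := by
    intro h0
    have h1 := hns 0 (zero_mem _)
    rw [zero_pow two_ne_zero, zero_sub, Valuation.map_neg] at h1
    have : red ε₀ ≠ 0 := red_ne_zero_of_valuation_eq_one h1
    rw [show ε₀ = ((e : 𝒪[(v.adicCompletion ↥(maximalRealSubfield L))]) : (v.adicCompletion ↥(maximalRealSubfield L))) from rfl, red_coe] at this
    exact this h0
  -- solve `x² + (−ē y² − n̄) = 0` in the residue field
  have hf : (X ^ 2 : 𝓀[(v.adicCompletion ↥(maximalRealSubfield L))][X]).degree = 2 := by rw [degree_X_pow]; rfl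
  have hg : (C (-IsLocalRing.residue 𝒪[(v.adicCompletion ↥(maximalRealSubfield L))] e) * X ^ 2 - C nbar : 𝓀[(v.adicCompletion ↥(maximalRealSubfield L))][X]).degree = 2 := by
    rw [degree_sub_eq_left_of_degree_lt] <;> rw [degree_C_mul_X_pow 2 (neg_ne_zero.2 hebar)]
    · rfl
    · exact lt_of_le_of_lt degree_C_le (by decide)
  obtain ⟨abar, bbar, hab⟩ := FiniteField.exists_root_sum_quadratic hf hg hodd
  simp only [eval_pow, eval_X, eval_sub, eval_mul, eval_C] at hab
  obtain ⟨a, ha⟩ := IsLocalRing.residue_surjective abar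
  obtain ⟨b, hb⟩ := IsLocalRing.residue_surjective bbar
  have hres : IsLocalRing.residue 𝒪[(v.adicCompletion ↥(maximalRealSubfield L))] (a ^ 2 - e * b ^ 2) = nbar := by
    rw [map_sub, map_mul, map_pow, map_pow, ha, hb]; linear_combination hab
  have hcoe : ((a ^ 2 - e * b ^ 2 : 𝒪[(v.adicCompletion ↥(maximalRealSubfield L))]) : (v.adicCompletion ↥(maximalRealSubfield L))) = (a : (v.adicCompletion ↥(maximalRealSubfield L))) ^ 2 - ε₀ * (b : (v.adicCompletion ↥(maximalRealSubfield L))) ^ 2 := by push_cast; rfl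
  refine ⟨a, b, a.2, b.2, ?_, fun x hx => ?_⟩
  · rw [← hcoe]
    refine valuation_eq_one_of_red_ne_zero (a ^ 2 - e * b ^ 2).2 ?_
    rw [red_coe, hres]
    rintro rfl; exact hn (IsSquare.zero)
  · have hcoe' : x ^ 2 - ((a : (v.adicCompletion ↥(maximalRealSubfield L))) ^ 2 - ε₀ * (b : (v.adicCompletion ↥(maximalRealSubfield L))) ^ 2) = (((⟨x, hx⟩ : 𝒪[(v.adicCompletion ↥(maximalRealSubfield L))]) ^ 2 - (a ^ 2 - e * b ^ 2) : 𝒪[(v.adicCompletion ↥(maximalRealSubfield L))]) : (v.adicCompletion ↥(maximalRealSubfield L))) := by push_cast; rfl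
    rw [hcoe']
    refine valuation_eq_one_of_red_ne_zero (sub_mem (pow_mem hx 2) (a ^ 2 - e * b ^ 2).2) fun h0 => hn ?_
    rw [red_coe, map_sub, map_pow, hres, sub_eq_zero] at h0
    exact ⟨IsLocalRing.residue 𝒪[(v.adicCompletion ↥(maximalRealSubfield L))] ⟨x, hx⟩, by rw [← h0, sq]⟩

omit [IsCMField L] in
/-- **A COMMUTING ELEMENT WITH DETERMINANT OF NON-SQUARE RESIDUE.**  For `g ∈ M₂(L⁺_v)` with `tr g = t`, `det g = d`, `t² − 4d = ε₀z²` (`ε₀` a unit of non-square residue,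
`z ≠ 0`, `|2| = 1`) there is `g₀ = a·1 + b′·(g − ½t·1)` with `g₀·g = g·g₀` and `det g₀` a unit of NON-SQUARE residue (`|x² − det g₀|_v = 1` on `𝒪_v`): with `b′ = 2b∕z`,
`det g₀ = a² − ε₀b²` (§2 and ★ I's Cayley–Hamilton). [cite: LabesseLanglands1979, §2 p. 7] [cite: Serre1979, Ch. XIV §4] -/
theorem exists_commuting_det_nonsquare (h2 : Valued.v (2 : (v.adicCompletion ↥(maximalRealSubfield L))) = 1)
    {ε₀ : (v.adicCompletion ↥(maximalRealSubfield L))} (hε₀ : ε₀ ∈ 𝒪[(v.adicCompletion ↥(maximalRealSubfield L))]) (hns : ∀ x : (v.adicCompletion ↥(maximalRealSubfield L)), x ∈ 𝒪[(v.adicCompletion ↥(maximalRealSubfield L))] → valuation (v.adicCompletion ↥(maximalRealSubfield L)) (x ^ 2 - ε₀) = 1)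
    (g : Matrix (Fin 2) (Fin 2) (v.adicCompletion ↥(maximalRealSubfield L))) {t d z : (v.adicCompletion ↥(maximalRealSubfield L))} (htr : g.trace = t) (hdet : g.det = d) (hz : z ≠ 0) (hD : t ^ 2 - 4 * d = ε₀ * z ^ 2) :
    ∃ g₀ : Matrix (Fin 2) (Fin 2) (v.adicCompletion ↥(maximalRealSubfield L)), g₀ * g = g * g₀ ∧ valuation (v.adicCompletion ↥(maximalRealSubfield L)) g₀.det = 1 ∧ ∀ x : (v.adicCompletion ↥(maximalRealSubfield L)), x ∈ 𝒪[(v.adicCompletion ↥(maximalRealSubfield L))] → valuation (v.adicCompletion ↥(maximalRealSubfield L)) (x ^ 2 - g₀.det) = 1 := by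
  have h20 : (2 : (v.adicCompletion ↥(maximalRealSubfield L))) ≠ 0 := fun h0 => zero_ne_one (by rw [h0, map_zero] at h2; exact h2)
  obtain ⟨a, b, -, -, hunit, hnsq⟩ := exists_residual_norm_nonsquare L v h2 hε₀ hns
  have hdet₀ : (a • (1 : Matrix (Fin 2) (Fin 2) (v.adicCompletion ↥(maximalRealSubfield L))) + (2 * b / z) • (g - (t / 2) • (1 : Matrix (Fin 2) (Fin 2) (v.adicCompletion ↥(maximalRealSubfield L))))).det =
      a ^ 2 - ε₀ * b ^ 2 := by
    set ν : (v.adicCompletion ↥(maximalRealSubfield L)) := (2 : (v.adicCompletion ↥(maximalRealSubfield L)))⁻¹ with hνdef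
    set z' : (v.adicCompletion ↥(maximalRealSubfield L)) := z⁻¹ with hz'def
    have hν : ν * 2 = 1 := inv_mul_cancel₀ h20
    have hzz : z * z' = 1 := mul_inv_cancel₀ hz
    rw [show t / 2 = t * ν from div_eq_mul_inv t 2, show 2 * b / z = 2 * b * z' from div_eq_mul_inv _ _]
    rw [Matrix.trace_fin_two] at htr
    rw [Matrix.det_fin_two] at hdet ⊢
    simp only [Matrix.add_apply, Matrix.smul_apply, Matrix.sub_apply, Matrix.one_apply_eq, Matrix.one_apply_ne (show (0 : Fin 2) ≠ 1 by decide),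
      Matrix.one_apply_ne (show (1 : Fin 2) ≠ 0 by decide), smul_eq_mul, mul_one, mul_zero, sub_zero]
    linear_combination (a * (2 * b * z') - (2 * b * z') ^ 2 * t * ν) * htr + (2 * b * z') ^ 2 * hdet - b ^ 2 * z' ^ 2 * hD +
      (-(a * (2 * b * z') * t) + b ^ 2 * z' ^ 2 * t ^ 2 * (ν * 2 - 1)) * hν - ε₀ * b ^ 2 * (z * z' + 1) * hzz
  refine ⟨a • (1 : Matrix (Fin 2) (Fin 2) (v.adicCompletion ↥(maximalRealSubfield L))) + (2 * b / z) • (g - (t / 2) • (1 : Matrix (Fin 2) (Fin 2) (v.adicCompletion ↥(maximalRealSubfield L)))), ?_, ?_, ?_⟩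
  · rw [Matrix.add_mul, Matrix.mul_add, Matrix.smul_mul, Matrix.mul_smul, Matrix.one_mul, Matrix.mul_one, Matrix.smul_mul, Matrix.mul_smul, Matrix.sub_mul, Matrix.mul_sub,
      Matrix.smul_mul, Matrix.mul_smul, Matrix.one_mul, Matrix.mul_one]
  · rw [hdet₀]; exact hunit
  · intro x hx
    rw [hdet₀]; exact hnsq x hx

end NonSquare

/-! ## §3 The class-flipping similitude of a type-(2) element -/

section Flip

variable (L : Type) [Field L] [NumberField L] [IsCMField L] (v : HeightOneSpectrum (𝓞 ↥(maximalRealSubfield L)))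
  (w : PlacesOver L v) (hw : IsCMField.complexConj L • w.1 = w.1)

include hw in
/-- **THE CLASS-FLIPPING SIMILITUDE.**  For `u ∈ U(σ_w, Φ₂)(L_w)` with (W1) descent `D_ϖ u D_ϖ⁻¹ = s·ι(g)`, `tr²g − 4 det g = ε₀z²` (`ε₀` a unit of non-square residue, `z ≠ 0`,
`|2|_v = 1`): there are `X₀ ∈ GL₂(L_w)` and `ν ∈ L⁺_v` with `ᵗσ_w(X₀)·J·X₀ = ι(ν)·J` (`J = antidiag(1,1)`), `|ν|_v = 1`, `|y² − ν|_v = 1` for all `y ∈ 𝒪_v` (NON-SQUARE residue),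
`X₀·u = u·X₀`, and `X₀ h X₀⁻¹ ∈ U(σ_w, Φ₂)` for every `h ∈ U(σ_w, Φ₂)` — namely `X₀ = D_ϖ⁻¹·ι(g₀)·D_ϖ` for the commuting `g₀` of §2.  (Organ (B-ii) step 1; the flip of the
residual classes along `B ↦ X₀B` is file 2.) [cite: LabesseLanglands1979, §2 p. 7] [cite: Rogawski1990, §4.9 p. 55] [cite: Serre1979, Ch. XIV §4] -/
theorem exists_classFlip_similitude (h2v : Valued.v (2 : (v.adicCompletion ↥(maximalRealSubfield L))) = 1)
    (ϖ : (w.1.adicCompletion L)ˣ) (hσϖ : galAdicCompletionMap (L := L) (IsCMField.complexConj L) hw (ϖ : (w.1.adicCompletion L)) = -(ϖ : (w.1.adicCompletion L)))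
    (u : ↥(unitaryGroupOfForm (galAdicCompletionMap (L := L) (IsCMField.complexConj L) hw) (placeForm (Matrix.of fun i j : Fin 2 => if i.val + j.val + 1 = 2 then (1 : L) else 0) w.1)))
    {s : (w.1.adicCompletion L)} {g : GL (Fin 2) (v.adicCompletion ↥(maximalRealSubfield L))}
    (hsg : Matrix.diagonal ![1, (ϖ : (w.1.adicCompletion L))] * ((u : GL (Fin 2) (w.1.adicCompletion L)) : Matrix (Fin 2) (Fin 2) (w.1.adicCompletion L)) * Matrix.diagonal ![1, (ϖ : (w.1.adicCompletion L))⁻¹] =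
      s • (g : Matrix (Fin 2) (Fin 2) (v.adicCompletion ↥(maximalRealSubfield L))).map (toPlace v w))
    {ε₀ : (v.adicCompletion ↥(maximalRealSubfield L))} (hε₀ : ε₀ ∈ 𝒪[(v.adicCompletion ↥(maximalRealSubfield L))]) (hns : ∀ x : (v.adicCompletion ↥(maximalRealSubfield L)), x ∈ 𝒪[(v.adicCompletion ↥(maximalRealSubfield L))] → valuation (v.adicCompletion ↥(maximalRealSubfield L)) (x ^ 2 - ε₀) = 1)
    {z : (v.adicCompletion ↥(maximalRealSubfield L))} (hz : z ≠ 0) (hD : (g : Matrix (Fin 2) (Fin 2) (v.adicCompletion ↥(maximalRealSubfield L))).trace ^ 2 - 4 * (g : Matrix (Fin 2) (Fin 2) (v.adicCompletion ↥(maximalRealSubfield L))).det = ε₀ * z ^ 2) :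
    ∃ (X₀ : GL (Fin 2) (w.1.adicCompletion L)) (ν : (v.adicCompletion ↥(maximalRealSubfield L))),
      ((X₀ : Matrix (Fin 2) (Fin 2) (w.1.adicCompletion L)).map (galAdicCompletionMap (L := L) (IsCMField.complexConj L) hw))ᵀ * !![(0 : (w.1.adicCompletion L)), 1; 1, 0] * (X₀ : Matrix (Fin 2) (Fin 2) (w.1.adicCompletion L)) =
          toPlace v w ν • !![(0 : (w.1.adicCompletion L)), 1; 1, 0] ∧
      valuation (v.adicCompletion ↥(maximalRealSubfield L)) ν = 1 ∧ (∀ y : (v.adicCompletion ↥(maximalRealSubfield L)), y ∈ 𝒪[(v.adicCompletion ↥(maximalRealSubfield L))] → valuation (v.adicCompletion ↥(maximalRealSubfield L)) (y ^ 2 - ν) = 1) ∧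
      (X₀ : Matrix (Fin 2) (Fin 2) (w.1.adicCompletion L)) * ((u : GL (Fin 2) (w.1.adicCompletion L)) : Matrix (Fin 2) (Fin 2) (w.1.adicCompletion L)) = ((u : GL (Fin 2) (w.1.adicCompletion L)) : Matrix (Fin 2) (Fin 2) (w.1.adicCompletion L)) * (X₀ : Matrix (Fin 2) (Fin 2) (w.1.adicCompletion L)) ∧
      ∀ h : GL (Fin 2) (w.1.adicCompletion L), h ∈ unitaryGroupOfForm (galAdicCompletionMap (L := L) (IsCMField.complexConj L) hw) (placeForm (Matrix.of fun i j : Fin 2 => if i.val + j.val + 1 = 2 then (1 : L) else 0) w.1) →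
        X₀ * h * X₀⁻¹ ∈ unitaryGroupOfForm (galAdicCompletionMap (L := L) (IsCMField.complexConj L) hw) (placeForm (Matrix.of fun i j : Fin 2 => if i.val + j.val + 1 = 2 then (1 : L) else 0) w.1) := by
  have hϖ0 : (ϖ : (w.1.adicCompletion L)) ≠ 0 := ϖ.ne_zero
  have hσι : ∀ x, galAdicCompletionMap (L := L) (IsCMField.complexConj L) hw (toPlace v w x) = toPlace v w x :=
    fun x => galAdicCompletionMap_toPlace (IsCMField.complexConj L) w w hw x
  obtain ⟨g₀, hcomm, hdet1, hnsq⟩ := exists_commuting_det_nonsquare L v h2v hε₀ hns (g : Matrix (Fin 2) (Fin 2) (v.adicCompletion ↥(maximalRealSubfield L))) rfl rfl hz hD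
  -- `X₀ = D⁻¹ ι(g₀) D`
  set X : Matrix (Fin 2) (Fin 2) (w.1.adicCompletion L) := Matrix.diagonal ![1, (ϖ : (w.1.adicCompletion L))⁻¹] * g₀.map (toPlace v w) * Matrix.diagonal ![1, (ϖ : (w.1.adicCompletion L))] with hXdef
  have hsim := formCongr_conj_diagonal_map (toPlace v w) (galAdicCompletionMap (L := L) (IsCMField.complexConj L) hw) hσι hσϖ hϖ0 g₀
  have hdet0 : g₀.det ≠ 0 := fun h0 => by rw [h0, map_zero] at hdet1; exact zero_ne_one hdet1
  have hXdet : X.det ≠ 0 := by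
    rw [hXdef, Matrix.det_mul, Matrix.det_mul, ← RingHom.mapMatrix_apply, ← RingHom.map_det, Matrix.det_diagonal, Matrix.det_diagonal]
    simp [Fin.prod_univ_two, hϖ0, hdet0]
  set X₀ : GL (Fin 2) (w.1.adicCompletion L) := Matrix.GeneralLinearGroup.mk'' X (isUnit_iff_ne_zero.2 hXdet) with hX₀
  have hX₀coe : (X₀ : Matrix (Fin 2) (Fin 2) (w.1.adicCompletion L)) = X := rfl
  -- `u = D⁻¹ (s ι g) D`
  have hD := diagonal_inv_mul_diagonal (E := (w.1.adicCompletion L)) hϖ0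
  have hD' := diagonal_mul_diagonal_inv (E := (w.1.adicCompletion L)) hϖ0
  have huv : ((u : GL (Fin 2) (w.1.adicCompletion L)) : Matrix (Fin 2) (Fin 2) (w.1.adicCompletion L)) = Matrix.diagonal ![1, (ϖ : (w.1.adicCompletion L))⁻¹] * (s • (g : Matrix (Fin 2) (Fin 2) (v.adicCompletion ↥(maximalRealSubfield L))).map (toPlace v w)) * Matrix.diagonal ![1, (ϖ : (w.1.adicCompletion L))] := by
    rw [← hsg]
    calc ((u : GL (Fin 2) (w.1.adicCompletion L)) : Matrix (Fin 2) (Fin 2) (w.1.adicCompletion L))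
        = (Matrix.diagonal ![1, (ϖ : (w.1.adicCompletion L))⁻¹] * Matrix.diagonal ![1, (ϖ : (w.1.adicCompletion L))]) * ((u : GL (Fin 2) (w.1.adicCompletion L)) : Matrix (Fin 2) (Fin 2) (w.1.adicCompletion L)) *
            (Matrix.diagonal ![1, (ϖ : (w.1.adicCompletion L))⁻¹] * Matrix.diagonal ![1, (ϖ : (w.1.adicCompletion L))]) := by rw [hD, Matrix.one_mul, Matrix.mul_one]
      _ = _ := by simp only [Matrix.mul_assoc]
  refine ⟨X₀, g₀.det, by rw [hX₀coe, hXdef]; exact hsim, hdet1, hnsq, ?_, fun h hh => ?_⟩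
  · -- commutation
    rw [hX₀coe, hXdef, huv]
    have hιcomm : g₀.map (toPlace v w) * (s • (g : Matrix (Fin 2) (Fin 2) (v.adicCompletion ↥(maximalRealSubfield L))).map (toPlace v w)) = (s • (g : Matrix (Fin 2) (Fin 2) (v.adicCompletion ↥(maximalRealSubfield L))).map (toPlace v w)) * g₀.map (toPlace v w) := by
      rw [Matrix.mul_smul, Matrix.smul_mul, ← Matrix.map_mul, hcomm, Matrix.map_mul]
    calc Matrix.diagonal ![1, (ϖ : (w.1.adicCompletion L))⁻¹] * g₀.map (toPlace v w) * Matrix.diagonal ![1, (ϖ : (w.1.adicCompletion L))] *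
          (Matrix.diagonal ![1, (ϖ : (w.1.adicCompletion L))⁻¹] * (s • (g : Matrix (Fin 2) (Fin 2) (v.adicCompletion ↥(maximalRealSubfield L))).map (toPlace v w)) * Matrix.diagonal ![1, (ϖ : (w.1.adicCompletion L))])
        = Matrix.diagonal ![1, (ϖ : (w.1.adicCompletion L))⁻¹] * (g₀.map (toPlace v w) * ((Matrix.diagonal ![1, (ϖ : (w.1.adicCompletion L))] * Matrix.diagonal ![1, (ϖ : (w.1.adicCompletion L))⁻¹]) *
            (s • (g : Matrix (Fin 2) (Fin 2) (v.adicCompletion ↥(maximalRealSubfield L))).map (toPlace v w)))) * Matrix.diagonal ![1, (ϖ : (w.1.adicCompletion L))] := by simp only [Matrix.mul_assoc]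
      _ = Matrix.diagonal ![1, (ϖ : (w.1.adicCompletion L))⁻¹] * ((s • (g : Matrix (Fin 2) (Fin 2) (v.adicCompletion ↥(maximalRealSubfield L))).map (toPlace v w)) * ((Matrix.diagonal ![1, (ϖ : (w.1.adicCompletion L))] * Matrix.diagonal ![1, (ϖ : (w.1.adicCompletion L))⁻¹]) *
            g₀.map (toPlace v w))) * Matrix.diagonal ![1, (ϖ : (w.1.adicCompletion L))] := by rw [hD', Matrix.one_mul, Matrix.one_mul, hιcomm]
      _ = _ := by simp only [Matrix.mul_assoc]
  · -- conjugation preserves `U`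
    rw [unitaryGroupOfForm_placeForm_antidiagTwo_eq] at hh ⊢
    exact conj_mem_unitaryGroupOfForm_of_similitude (galAdicCompletionMap (L := L) (IsCMField.complexConj L) hw) X₀ (by rw [hX₀coe, hXdef]; exact hsim) h hh

end Flip

end Literature.NumberTheory.Automorphic.UnitaryGroup

end
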